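import Mathlib
import Summits.Ventures.PercRepro2.EdgeSurgery
import Summits.Ventures.PercRepro2.A3PendantFreeLeaf

/-!
# The leaf expansion of (MEANS-a₃) tolerates edges of weight `0` at the leaf
(blind cell PercRepro2, night-1 g32; proofs/NIGHT1-G32.md §2)

Every leaf theorem of night-1 g31 (`btw_leaf_free`, `A3Between_leaf_free_of`, `FMfun_leaf`) needs the
SET hypothesis `hleaf : ∀ e, a₃ ∈ ends e → e = f` («`f` is the only edge at `a₃`»).  By the edge surgery
of EdgeSurgery.lean the hypothesis can be weakened to «every edge at `a₃` other than `f` has weight `0`»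
(`hz : ∀ e, a₃ ∈ ends e → e ≠ f → p e = 0`): re-routing those edges to a loop at `v` (`leafSurg`) changes
no probability and makes `a₃` a true leaf.  Consequences: (i) `btw_leaf_free_z`, `A3Between_leaf_free_z_of`,
`HCov_leaf_free_z_of`, `FMfun_leaf_z` — the g31 statements with `hz` in place of `hleaf`; (ii) with p5's
root-edge closure `RootEdge.A3Between_of_noRootEdge_class'`, **`A3Between_leaf_rootEdges_of`**: (MEANS-a₃)
at an `a₃` joined to `v` by `f` and to the roots by ANY further edges follows from (MEANS-a₃)(v) ∧ (FM)(v)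
on the instances with those root edges deleted.  Standard axioms.
-/

namespace Summit.Ventures.PercRepro2

open UnionCluster CovForm

namespace CovForm

namespace A3Fibre

/-! ## The leaf surgery -/

section LeafSurg

variable {V : Type*} {E : Type*} [DecidableEq V] [DecidableEq E]

/-- The leaf surgery: every edge at `a₃` other than `f` is re-routed to a loop at `v`. -/
def leafSurg (ends : E → Sym2 V) (f : E) (a₃ v : V) : E → Sym2 V :=
  fun e => if a₃ ∈ ends e ∧ e ≠ f then s(v, v) else ends e

/-- The surgery keeps `f`. -/
lemma leafSurg_apply_self (ends : E → Sym2 V) (f : E) (a₃ v : V) :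
    leafSurg ends f a₃ v f = ends f := by
  simp [leafSurg]

/-- After the surgery `f` is the only edge at `a₃`. -/
lemma leafSurg_leaf (ends : E → Sym2 V) (f : E) {a₃ v : V} (h3v : a₃ ≠ v) :
    ∀ e, a₃ ∈ leafSurg ends f a₃ v e → e = f := by
  intro e he
  unfold leafSurg at he
  split_ifs at he with h
  · exfalso
    rw [Sym2.mem_iff] at he
    rcases he with h' | h' <;> exact h3v h'
  · by_contra hef
    exact h ⟨he, hef⟩

/-- The surgery only touches edges of weight `0` when every edge at `a₃` other than `f` has weight `0`. -/
lemma leafSurg_zero_off {R : Type*} [CommRing R] {p : E → R} {ends : E → Sym2 V} {f : E} {a₃ : V}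
    (hz : ∀ e, a₃ ∈ ends e → e ≠ f → p e = 0) (v : V) :
    ∀ e, ends e ≠ leafSurg ends f a₃ v e → p e = 0 := by
  intro e he
  unfold leafSurg at he
  split_ifs at he with h
  · exact hz e h.1 h.2
  · exact absurd rfl he

end LeafSurg

/-! ## The g31 leaf theorems with weight-`0` edges at the leaf -/

section Main

variable {V : Type*} {E : Type*} [Fintype V] [DecidableEq V] [Fintype E] [DecidableEq E]
  {R : Type*} [Field R] [LinearOrder R] [IsStrictOrderedRing R]
  {ends : E → Sym2 V} {f : E} {a₃ v : V}

/-- **The leaf expansion with weight-`0` edges at the leaf**: `btw_leaf_free` with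
`hz : ∀ e, a₃ ∈ ends e → e ≠ f → p e = 0` in place of «`f` is the only edge at `a₃`». -/
theorem btw_leaf_free_z {p : E → R} (hp : IsProbVec p) (hf : ends f = s(a₃, v))
    (hz : ∀ e, a₃ ∈ ends e → e ≠ f → p e = 0) (h3v : a₃ ≠ v) {o a₁ a₂ b : V} (h31 : a₃ ≠ a₁)
    (h32 : a₃ ≠ a₂) (ho : o ≠ a₃) (hb : b ≠ a₃) (hD : prob p (PDEvent ends a₁ a₂ a₃) ≠ 0) :
    btw p ends o a₁ a₂ a₃ b =
      p f * ((1 - (1 - p f) * prob p (avoidAll ends a₂ {a₁}) / prob p (PDEvent ends a₁ a₂ a₃)) *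
          btw (Function.update p f 1) ends o a₁ a₂ v b +
        (1 - p f) * prob p (avoidAll ends a₂ {a₁}) / prob p (PDEvent ends a₁ a₂ a₃) *
          FMfun (Function.update p f 1) ends o a₁ a₂ v b) := by
  have hS : ∀ e, ends e ≠ leafSurg ends f a₃ v e → p e = 0 := leafSurg_zero_off hz v
  have hS₁ : ∀ e, ends e ≠ leafSurg ends f a₃ v e → Function.update p f 1 e = 0 :=
    zero_off_update hS (leafSurg_apply_self ends f a₃ v).symm 1
  have hf' : leafSurg ends f a₃ v f = s(a₃, v) := by rw [leafSurg_apply_self, hf]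
  rw [btw_surg hS, probQ_surg hS, probPD_surg hS, btw_surg hS₁, FMfun_surg hS₁]
  rw [probPD_surg hS] at hD
  exact btw_leaf_free hp hf' (leafSurg_leaf ends f h3v) h3v h31 h32 ho hb hD

/-- **(MEANS-a₃) at a leaf with weight-`0` edges from (MEANS-a₃) ∧ (FM) at the attachment vertex.** -/
theorem A3Between_leaf_free_z_of {p : E → R} (hp : IsProbVec p) (hf : ends f = s(a₃, v))
    (hz : ∀ e, a₃ ∈ ends e → e ≠ f → p e = 0) (h3v : a₃ ≠ v) {o a₁ a₂ b : V} (h31 : a₃ ≠ a₁)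
    (h32 : a₃ ≠ a₂) (ho : o ≠ a₃) (hb : b ≠ a₃)
    (hv : A3Between (Function.update p f 1) ends o a₁ a₂ v b)
    (hFM : 0 ≤ FMfun (Function.update p f 1) ends o a₁ a₂ v b) :
    A3Between p ends o a₁ a₂ a₃ b := by
  have hS : ∀ e, ends e ≠ leafSurg ends f a₃ v e → p e = 0 := leafSurg_zero_off hz v
  have hS₁ : ∀ e, ends e ≠ leafSurg ends f a₃ v e → Function.update p f 1 e = 0 :=
    zero_off_update hS (leafSurg_apply_self ends f a₃ v).symm 1
  have hf' : leafSurg ends f a₃ v f = s(a₃, v) := by rw [leafSurg_apply_self, hf]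
  rw [A3Between_surg hS]
  rw [A3Between_surg hS₁] at hv
  rw [FMfun_surg hS₁] at hFM
  exact A3Between_leaf_free_of hp hf' (leafSurg_leaf ends f h3v) h3v h31 h32 ho hb hv hFM

/-- **(HCOV) at a leaf with weight-`0` edges from (MEANS-a₃) ∧ (FM) at the attachment vertex.** -/
theorem HCov_leaf_free_z_of {p : E → R} (hp : IsProbVec p) (hf : ends f = s(a₃, v))
    (hz : ∀ e, a₃ ∈ ends e → e ≠ f → p e = 0) (h3v : a₃ ≠ v) {o a₁ a₂ b : V} (h31 : a₃ ≠ a₁)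
    (h32 : a₃ ≠ a₂) (ho : o ≠ a₃) (hb : b ≠ a₃)
    (hv : A3Between (Function.update p f 1) ends o a₁ a₂ v b)
    (hFM : 0 ≤ FMfun (Function.update p f 1) ends o a₁ a₂ v b) :
    HCov p ends o a₁ a₂ a₃ b :=
  HCov_of_a3Between hp ends o a₁ a₂ a₃ b (A3Between_leaf_free_z_of hp hf hz h3v h31 h32 ho hb hv hFM)

/-- **The leaf closure of (FM) with weight-`0` edges at the leaf**: `FMfun_leaf` with `hz` in place of
«`g` is the only edge at `v`». -/
theorem FMfun_leaf_z {p : E → R} {g : E} {x : V} (hp : IsProbVec p) (hg : ends g = s(v, x))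
    (hz : ∀ e, v ∈ ends e → e ≠ g → p e = 0) (hvx : v ≠ x) {o a₁ a₂ b : V} (hv1 : v ≠ a₁)
    (hv2 : v ≠ a₂) (ho : o ≠ v) (hb : b ≠ v) (hQ : prob p (avoidAll ends a₂ {a₁}) ≠ 0) :
    FMfun p ends o a₁ a₂ v b = p g * FMfun (Function.update p g 1) ends o a₁ a₂ x b := by
  have hS : ∀ e, ends e ≠ leafSurg ends g v x e → p e = 0 := leafSurg_zero_off hz x
  have hS₁ : ∀ e, ends e ≠ leafSurg ends g v x e → Function.update p g 1 e = 0 :=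
    zero_off_update hS (leafSurg_apply_self ends g v x).symm 1
  have hg' : leafSurg ends g v x g = s(v, x) := by rw [leafSurg_apply_self, hg]
  rw [FMfun_surg hS, FMfun_surg hS₁]
  rw [probQ_surg hS] at hQ
  exact FMfun_leaf hp hg' (leafSurg_leaf ends g hvx) hvx hv1 hv2 ho hb hQ

/-- **(MEANS-a₃) at an `a₃` joined to `v` by `f` and to the roots by any further edges**: by p5's
root-edge closure it suffices to have (MEANS-a₃)(v) ∧ (FM)(v) under `p'[f ↦ 1]` for every admissible
`p'` in which those root edges have weight `0`. -/
theorem A3Between_leaf_rootEdges_of {p : E → R} (hp : IsProbVec p) (hf : ends f = s(a₃, v))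
    {o a₁ a₂ b : V} (hr : ∀ e, a₃ ∈ ends e → e ≠ f → RootEdge.IsRootEdge ends a₁ a₂ a₃ e)
    (h3v : a₃ ≠ v) (h31 : a₃ ≠ a₁) (h32 : a₃ ≠ a₂) (ho : o ≠ a₃) (hb : b ≠ a₃)
    (hv : ∀ p' : E → R, IsProbVec p' → RootEdge.NoRootEdge p' ends a₁ a₂ a₃ →
      A3Between (Function.update p' f 1) ends o a₁ a₂ v b ∧
        0 ≤ FMfun (Function.update p' f 1) ends o a₁ a₂ v b) :
    A3Between p ends o a₁ a₂ a₃ b := by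
  refine RootEdge.A3Between_of_noRootEdge_class' p hp ends o a₁ a₂ a₃ b fun p' hp' hn => ?_
  obtain ⟨h1, h2⟩ := hv p' hp' hn
  exact A3Between_leaf_free_z_of hp' hf (fun e he hef => hn e (hr e he hef)) h3v h31 h32 ho hb h1 h2

end Main

end A3Fibre

end CovForm

end Summit.Ventures.PercRepro2
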